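/-
Copyright (c) 2026 the pub-hodgecm-mathlib formalisation cell (harness21).  Prover seat hodgecm-mathlib-K2E5-p16 (g8), squad K2 ∕ cell hodgecm-mathlib, helper lane
`--supports stmt-HodgeConjecture-24832` (hLiu418; count-neutral: closes no socket by itself).  Socket #41, KIND 1 a♮ «the X₀₁-plane step», organ K1-a♮ (line lead K2E5-p16 (g8)),
brick (K1a-3)(c) «THE SUPPORT LETTER OF THE TWISTED RANK-ONE STAGE» (LINE LEAD WORD #8 (d1), 2026-09-04T23:51Z).
THEOREMS ONLY (no `def`, no `instance`, no notation, no named-fact hypothesis, no `sorry`).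
-/
import Summits.HodgeConjecture.HodgeConjecture.Theorems.K2LiuKindOneLineLatticeLetter   -- ★ (c4) p862912 (K2E3-p26): translation kills the twisted integral, the lattice letter
import Summits.HodgeConjecture.HodgeConjecture.Theorems.K2LiuRankOneOperators            -- ★ (F-GK) operators: `apply_mul_u_add` (the root variable modulo the level)
import HarnessLib

/-!
# The support letter of the twisted rank-one stage (K1-a♮, (K1a-3)(c))

HONEST LABEL: HC_CM is proved only modulo the 7 printed citations (2 remaining named inputs: hLiu418 = `stmt-HodgeConjecture-24832`,
h413 = `stmt-HodgeConjecture-24833`) until rung 0 closes.  This file is a count-neutral helper: it closes no socket.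

The twisted rank-one stage of socket #41's singular (KIND 1 a♮) term reads, at a finite place `w` of `K` and in the letters of ★ `K2LiuRankOneStageTwisted`
(`f` right-`K′`-invariant on a group `G`, a one-parameter root subgroup `u : K_w → G` with `u(x + t) = u(x)u(t)`, a Weyl letter `w₀`, a point `y` of LEVEL `m`:
`y⁻¹ u(𝔭_w^m) y ⊆ K′`, an additive character `ψ` of conductor exponent `d`, a twist `σ ∈ K_w`):
`∫ conj ψ(σx) · f(w₀ u(x) y) dμ(x)` — or its truncations to the balls `𝔭_w^n`, `n ≤ m` (★ F0P2-p11 `…StageTwistedBall`, clause (iii)).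

**THE SUPPORT LETTER.**  The integrand's `f`-factor is `𝔭_w^m`-periodic in `x` (★ `K2LiuRankOneOperators.apply_mul_u_add`), so the twisted integral — full or over any
ball `𝔭_w^n`, `n ≤ m` — VANISHES as soon as `x ↦ ψ(σx)` is non-trivial on `𝔭_w^m`, i.e. as soon as `|σ|_w > q_w^{m − d}` (★ (c4)
`K2LiuKindOneLineLatticeLetter.setIntegral_mul_addChar_eq_zero_of_translate` ∘ ★ (c2) `K2LiuCharacterTrivialBallNormBound.exists_apply_mul_ne_one_of_exp_lt_v`).
Contrapositively: **a non-zero twisted value forces `|σ|_w ≤ exp(m − d)`** — the place-`w ∈ T` half of the K1-a♮ support letter `hsuppa` of ★ p862515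
`K2LiuSiegelEisensteinContinuationTopSixteen` :181–:196 (the corner index `σ♭` has denominators bounded by the level of the translate `h_w`), the K1-a twin of ★ (c4)'s
line letter for K1-b♮.  No integrability is needed anywhere (a non-integrable integral is `0` on both sides of the substitution).

## Census (★ by name)
★ (c4) `K2LiuKindOneLineLatticeLetter.{integral_mul_addChar_eq_zero_of_translate, setIntegral_mul_addChar_eq_zero_of_translate, add_mem_ball_iff_of_v_le}` ·
★ (c2) `K2LiuCharacterTrivialBallNormBound.exists_apply_mul_ne_one_of_exp_lt_v` · ★ F-GK-1 `K2LiuRankOneOperators.apply_mul_u_add` ·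
★ Lit `AddCharConductorExponent.{mem_primePowBall_adicCompletion_iff, measurableSet_primePowBall}` · Mathlib `Circle.coe_inv_eq_conj`, `AddChar.map_neg_eq_inv`.
presearch: «Whittaker functional of a level-m vector vanishes off the dual lattice» → [Casselman1980 §3] (conductor of the Whittaker model), [Shimura1997 §18.4]
(support of Fourier coefficients of Eisenstein series in the level), [Tate1950 §2.2] (dual lattice `𝔭^{d−m}`); corpus+galaxy: the tree's ★ (c2)/(c4) ARE the method.
-/

set_option autoImplicit false
set_option linter.dupNamespace false -- the mandated namespace repeats `HodgeConjecture.HodgeConjecture`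

noncomputable section

open scoped NNReal ComplexConjugate
open NumberField IsDedekindDomain MeasureTheory
open Literature.NumberTheory.Automorphic

namespace Summit.HodgeConjecture.HodgeConjecture.Cruxes.HLiu418.K2LiuRankOneStageTwistedSupport

open Summit.HodgeConjecture.HodgeConjecture.Cruxes.HLiu418.K2LiuKindOneLineLatticeLetter
open Summit.HodgeConjecture.HodgeConjecture.Cruxes.HLiu418.K2LiuCharacterTrivialBallNormBound (exists_apply_mul_ne_one_of_exp_lt_v)
open Summit.HodgeConjecture.HodgeConjecture.Cruxes.HLiu418.K2LiuRankOneOperators (apply_mul_u_add)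

variable {K : Type} [Field K] [NumberField K] {w : HeightOneSpectrum (𝓞 K)} {G : Type*} [Group G]
variable [MeasurableSpace (w.adicCompletion K)] [BorelSpace (w.adicCompletion K)] (μ : Measure (w.adicCompletion K)) [μ.IsAddRightInvariant]

/-! ## §1 The twist in ★ (c4)'s currency: `conj ψ(σx) = ψ(x·(−σ))` -/

omit [MeasurableSpace (w.adicCompletion K)] [BorelSpace (w.adicCompletion K)] in
/-- `conj ψ(σ x) = ψ(x · (−σ))` (a unitary character: `conj = ⁻¹`, and `ψ(−a) = ψ(a)⁻¹`). [cite: Tate1950, §2.2] -/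
theorem conj_addChar_mul_eq (ψ : AddChar (w.adicCompletion K) Circle) (σ x : w.adicCompletion K) :
    conj ((ψ (σ * x) : ℂ)) = ((ψ (x * -σ) : Circle) : ℂ) := by
  rw [← Circle.coe_inv_eq_conj, ← AddChar.map_neg_eq_inv, mul_neg, mul_comm x σ]

omit [MeasurableSpace (w.adicCompletion K)] [BorelSpace (w.adicCompletion K)] in
/-- **PERIODICITY OF THE OPERATOR INTEGRAND MODULO THE LEVEL** (★ `apply_mul_u_add` in `Valued.v` currency): `y⁻¹ u(𝔭^m) y ⊆ K′` and `f` right-`K′`-invariant ⟹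
`f(w₀ u(b + b₀) y) = f(w₀ u(b) y)` for `|b₀|_w ≤ exp(−m)`. [cite: Casselman1980, §3] -/
theorem apply_mul_u_add_of_v_le {f : G → ℂ} {K' : Subgroup G} (hfK : ∀ g, ∀ k ∈ K', f (g * k) = f g)
    {u : w.adicCompletion K → G} (hu_add : ∀ x t, u (x + t) = u x * u t) (w₀ y : G) {m : ℤ}
    (hmu : ∀ t ∈ primePowBall (w.adicCompletion K) m, y⁻¹ * u t * y ∈ K') :
    ∀ b₀ : w.adicCompletion K, Valued.v b₀ ≤ WithZero.exp (-m) → ∀ b, f (w₀ * u (b + b₀) * y) = f (w₀ * u b * y) :=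
  fun _ hb₀ b => apply_mul_u_add hfK hu_add w₀ y hmu b ((mem_primePowBall_adicCompletion_iff w).2 hb₀)

/-! ## §2 The full twisted integral -/

/-- **THE TWISTED RANK-ONE VALUE VANISHES OFF THE DUAL LATTICE (full integral).**  `f` right-`K′`-invariant, `y` of level `m` for the root subgroup `u`
(`y⁻¹ u(𝔭^m) y ⊆ K′`), `ψ` of conductor exponent `d`, `|σ|_w > exp(m − d)` ⟹ `∫ conj ψ(σx) · f(w₀ u(x) y) dμ(x) = 0` (any right-invariant `μ`; no integrability needed).
[cite: Casselman1980, §3 Thm. 3.1] [cite: Shimura1997, §18.4] [cite: Tate1950, §2.2] -/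
theorem integral_conj_addChar_mul_apply_eq_zero_of_exp_lt {f : G → ℂ} {K' : Subgroup G} (hfK : ∀ g, ∀ k ∈ K', f (g * k) = f g)
    {u : w.adicCompletion K → G} (hu_add : ∀ x t, u (x + t) = u x * u t) (w₀ y : G) {m : ℤ}
    (hmu : ∀ t ∈ primePowBall (w.adicCompletion K) m, y⁻¹ * u t * y ∈ K')
    {ψ : AddChar (w.adicCompletion K) Circle} {d : ℤ} (hψ : ψ.HasConductorExp d) {σ : w.adicCompletion K} (hσ : WithZero.exp (m - d) < Valued.v σ) :
    ∫ x, conj ((ψ (σ * x) : ℂ)) * f (w₀ * u x * y) ∂μ = 0 := by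
  have hσ' : WithZero.exp (m - d) < Valued.v (-σ) := by rwa [Valuation.map_neg]
  obtain ⟨b₀, hb₀, hne⟩ := exists_apply_mul_ne_one_of_exp_lt_v w hψ hσ'
  rw [mul_comm (-σ) b₀] at hne
  simp_rw [conj_addChar_mul_eq, mul_comm (((ψ (_ * -σ) : Circle) : ℂ))]
  exact integral_mul_addChar_eq_zero_of_translate μ ψ (-σ) (apply_mul_u_add_of_v_le hfK hu_add w₀ y hmu b₀ hb₀) hne

/-- **SUPPORT FORM (full integral)**: a non-zero twisted value forces `|σ|_w ≤ exp(m − d)`. [cite: Casselman1980, §3 Thm. 3.1] [cite: Shimura1997, §18.4] -/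
theorem v_le_exp_of_integral_conj_addChar_mul_apply_ne_zero {f : G → ℂ} {K' : Subgroup G} (hfK : ∀ g, ∀ k ∈ K', f (g * k) = f g)
    {u : w.adicCompletion K → G} (hu_add : ∀ x t, u (x + t) = u x * u t) (w₀ y : G) {m : ℤ}
    (hmu : ∀ t ∈ primePowBall (w.adicCompletion K) m, y⁻¹ * u t * y ∈ K')
    {ψ : AddChar (w.adicCompletion K) Circle} {d : ℤ} (hψ : ψ.HasConductorExp d) {σ : w.adicCompletion K}
    (hI : ∫ x, conj ((ψ (σ * x) : ℂ)) * f (w₀ * u x * y) ∂μ ≠ 0) : Valued.v σ ≤ WithZero.exp (m - d) := by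
  by_contra h
  exact hI (integral_conj_addChar_mul_apply_eq_zero_of_exp_lt μ hfK hu_add w₀ y hmu hψ (not_le.1 h))

/-! ## §3 The truncations to the balls `𝔭^n`, `n ≤ m` (★ `…StageTwistedBall`'s clause (iii) currency) -/

omit [MeasurableSpace (w.adicCompletion K)] [BorelSpace (w.adicCompletion K)] in
/-- The ball `𝔭^n` is stable under translation by `𝔭^m` when `n ≤ m`. [cite: WeilBNT1967, Ch. II §4] -/
theorem add_mem_primePowBall_iff_of_le {n m : ℤ} (hnm : n ≤ m) {b₀ : w.adicCompletion K} (hb₀ : Valued.v b₀ ≤ WithZero.exp (-m)) (b : w.adicCompletion K) :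
    b + b₀ ∈ primePowBall (w.adicCompletion K) n ↔ b ∈ primePowBall (w.adicCompletion K) n := by
  have h := add_mem_ball_iff_of_v_le w (m := m) (k := -n) (by omega) hb₀ b
  simp only [Set.mem_setOf_eq] at h
  rw [mem_primePowBall_adicCompletion_iff, mem_primePowBall_adicCompletion_iff]
  exact h

/-- **THE TWISTED RANK-ONE BALL VALUES VANISH OFF THE DUAL LATTICE**: as §2 for `∫_{𝔭^n} conj ψ(σx) · f(w₀ u(x) y) dμ(x)`, every `n ≤ m` — so every ball value of
★ `…StageTwistedBall` (iii) (balls `𝔭^{−k}`, `k ≥ 0`, level `m ≥ 0`) is `0` once `|σ|_w > exp(m − d)`, for EVERY parameter `s` at which the level letter holds.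
[cite: Casselman1980, §3 Thm. 3.1] [cite: Shimura1997, §18.4] [cite: Tate1950, §2.2] -/
theorem setIntegral_conj_addChar_mul_apply_eq_zero_of_exp_lt {f : G → ℂ} {K' : Subgroup G} (hfK : ∀ g, ∀ k ∈ K', f (g * k) = f g)
    {u : w.adicCompletion K → G} (hu_add : ∀ x t, u (x + t) = u x * u t) (w₀ y : G) {m : ℤ}
    (hmu : ∀ t ∈ primePowBall (w.adicCompletion K) m, y⁻¹ * u t * y ∈ K')
    {ψ : AddChar (w.adicCompletion K) Circle} {d : ℤ} (hψ : ψ.HasConductorExp d) {σ : w.adicCompletion K} (hσ : WithZero.exp (m - d) < Valued.v σ)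
    {n : ℤ} (hnm : n ≤ m) :
    ∫ x in primePowBall (w.adicCompletion K) n, conj ((ψ (σ * x) : ℂ)) * f (w₀ * u x * y) ∂μ = 0 := by
  have hσ' : WithZero.exp (m - d) < Valued.v (-σ) := by rwa [Valuation.map_neg]
  obtain ⟨b₀, hb₀, hne⟩ := exists_apply_mul_ne_one_of_exp_lt_v w hψ hσ'
  rw [mul_comm (-σ) b₀] at hne
  simp_rw [conj_addChar_mul_eq, mul_comm (((ψ (_ * -σ) : Circle) : ℂ))]
  exact setIntegral_mul_addChar_eq_zero_of_translate μ ψ (-σ) (apply_mul_u_add_of_v_le hfK hu_add w₀ y hmu b₀ hb₀) hne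
    (measurableSet_primePowBall n) (add_mem_primePowBall_iff_of_le hnm hb₀)

/-- **SUPPORT FORM (balls)**: a non-zero twisted ball value over `𝔭^n`, `n ≤ m`, forces `|σ|_w ≤ exp(m − d)`. [cite: Casselman1980, §3 Thm. 3.1] [cite: Shimura1997, §18.4] -/
theorem v_le_exp_of_setIntegral_conj_addChar_mul_apply_ne_zero {f : G → ℂ} {K' : Subgroup G} (hfK : ∀ g, ∀ k ∈ K', f (g * k) = f g)
    {u : w.adicCompletion K → G} (hu_add : ∀ x t, u (x + t) = u x * u t) (w₀ y : G) {m : ℤ}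
    (hmu : ∀ t ∈ primePowBall (w.adicCompletion K) m, y⁻¹ * u t * y ∈ K')
    {ψ : AddChar (w.adicCompletion K) Circle} {d : ℤ} (hψ : ψ.HasConductorExp d) {σ : w.adicCompletion K} {n : ℤ} (hnm : n ≤ m)
    (hI : ∫ x in primePowBall (w.adicCompletion K) n, conj ((ψ (σ * x) : ℂ)) * f (w₀ * u x * y) ∂μ ≠ 0) :
    Valued.v σ ≤ WithZero.exp (m - d) := by
  by_contra h
  exact hI (setIntegral_conj_addChar_mul_apply_eq_zero_of_exp_lt μ hfK hu_add w₀ y hmu hψ (not_le.1 h) hnm)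

/-! ## §4 Family form, hypothesis-first on the ball presentation (★ `…StageTwistedBall` (iii): `N = ∫_{𝔭^{−k}} …` for all large `k`) -/

/-- **THE SUPPORT LETTER FOR A VALUE PRESENTED BY BALLS.**  If a number `N` equals the twisted ball value over `𝔭^{−k}` for all `k ≥ k₀` (★ `…StageTwistedBall` (iii) at a
parameter `s` and a point `g` of level `m ≥ 0`), then `N ≠ 0 ⟹ |σ|_w ≤ exp(m − d)`: take `k := max k₀ 0`, so that `−k ≤ 0 ≤ m`.  This is the place-`w ∈ T` half of
K1-a♮'s `hsuppa` for the factor `Gn_w(s, h_w)` of ★ `exists_Eac_of_tail_letters`' head. [cite: Casselman1980, §3 Thm. 3.1] [cite: Shimura1997, §18.4] [cite: Tate1950, §2.2] -/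
theorem v_le_exp_of_ballPresented_ne_zero {f : G → ℂ} {K' : Subgroup G} (hfK : ∀ g, ∀ k ∈ K', f (g * k) = f g)
    {u : w.adicCompletion K → G} (hu_add : ∀ x t, u (x + t) = u x * u t) (w₀ y : G) {m : ℕ}
    (hmu : ∀ t ∈ primePowBall (w.adicCompletion K) (m : ℤ), y⁻¹ * u t * y ∈ K')
    {ψ : AddChar (w.adicCompletion K) Circle} {d : ℤ} (hψ : ψ.HasConductorExp d) {σ : w.adicCompletion K} {N : ℂ} {k₀ : ℕ}
    (hball : ∀ k : ℕ, k₀ ≤ k → N = ∫ x in primePowBall (w.adicCompletion K) (-(k : ℤ)), conj ((ψ (σ * x) : ℂ)) * f (w₀ * u x * y) ∂μ)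
    (hN : N ≠ 0) : Valued.v σ ≤ WithZero.exp ((m : ℤ) - d) := by
  rw [hball (max k₀ 0) (le_max_left _ _)] at hN
  exact v_le_exp_of_setIntegral_conj_addChar_mul_apply_ne_zero μ hfK hu_add w₀ y hmu hψ (by omega) hN

/-- The same, vanishing form: `|σ|_w > exp(m − d) ⟹ N = 0`. [cite: Casselman1980, §3 Thm. 3.1] [cite: Shimura1997, §18.4] -/
theorem ballPresented_eq_zero_of_exp_lt {f : G → ℂ} {K' : Subgroup G} (hfK : ∀ g, ∀ k ∈ K', f (g * k) = f g)
    {u : w.adicCompletion K → G} (hu_add : ∀ x t, u (x + t) = u x * u t) (w₀ y : G) {m : ℕ}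
    (hmu : ∀ t ∈ primePowBall (w.adicCompletion K) (m : ℤ), y⁻¹ * u t * y ∈ K')
    {ψ : AddChar (w.adicCompletion K) Circle} {d : ℤ} (hψ : ψ.HasConductorExp d) {σ : w.adicCompletion K} (hσ : WithZero.exp ((m : ℤ) - d) < Valued.v σ)
    {N : ℂ} {k₀ : ℕ}
    (hball : ∀ k : ℕ, k₀ ≤ k → N = ∫ x in primePowBall (w.adicCompletion K) (-(k : ℤ)), conj ((ψ (σ * x) : ℂ)) * f (w₀ * u x * y) ∂μ) : N = 0 := by
  by_contra hN
  exact not_le.2 hσ (v_le_exp_of_ballPresented_ne_zero μ hfK hu_add w₀ y hmu hψ hball hN)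

end Summit.HodgeConjecture.HodgeConjecture.Cruxes.HLiu418.K2LiuRankOneStageTwistedSupport

end
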